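import Literature.Computability.MetaComplexity.AvgCaseNE
import Literature.Computability.Complexity.AaronsonVanMelkebeek2011Proofs
import HarnessLib

/-!
# Under `DistNP ⊆ AvgP`, `NTIME(2ⁿ) ⊆ DTIME(2^{en})` for ONE constant `e` (BFP, proof of Thm. 3.1)

Companion to `AvgCaseNE.lean` (`DistNP ⊆ AvgP ⟹ E = NE`, Buhrman–Fortnow–Pavan 2005, Thm. 3.5).
The proof of BFP's Thm. 3.1 (p. 6) continues: "Since `NP` is easy on average, by Theorem 3.5,
`E = NE`. Impagliazzo, Kabanets, and Wigderson [IKW02] showed that if `E = NE`, then there exists a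
fixed constant `e` such that `NTIME(2ⁿ) ⊆ DTIME(2^{en})`." The UNIFORM constant `e` (one `e` for all
of `NTIME(2ⁿ)`, chosen before the diagonal language of the proof is fixed) comes from completeness:
`NTIME(2^{O(n)})` has a complete language under linear-length polynomial-time reductions, and it
suffices to collapse that one language. This file PROVES the statement in that form, directly from
the average-case hypothesis:

* `AvgNEU.K_mem_NTIME_lin` — the bounded-acceptance language `AvM.K U` of
  `AaronsonVanMelkebeek2011Proofs.lean` (Aaronson–van Melkebeek 2011, §3.3: "`{⟨M, x, t⟩ | M is a
  nondeterministic Turing machine that accepts `x` in at most `t` steps}`") is in `NTIME(2^{c₁n})`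
  for some `c₁ ≥ 1` (the tree's `AvM.K_mem_NTIME` records only `NTIME(2^{n²})`; the verifier is the
  same, its time is re-estimated);
* `AvgNEU.exists_reduction` — every `L ∈ NTIME(2^{c₀n})` reduces to `AvM.K ClockedUA.U` by an `FP`
  map of length `≤ (2 + 3c₀)|x| + β` (the reduction of `AvM.reduction`, made explicit and
  computable, with the LINEAR overhead polynomial `ClockedUA.pM` of the tree's clocked universal
  machine, `ClockedUniversalAcceptanceProofs.lean`, so that the slope does not depend on `L`);
* **`exists_NTIME_two_pow_subset_DTIME_of_DistNP_subset_AvgP`** — `DistNP ⊆ AvgP ⟹ ∃ e,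
  NTIME(2ⁿ) ⊆ DTIME(2^{en})`: `AvM.K U ∈ NTIME(2^{c₁n}) ⊆ E` by `AvgCaseNE.lean`, say in
  `DTIME(2^{e₀n})`, and every `L ∈ NTIME(2ⁿ)` is the preimage of it under a reduction of slope `5`,
  whence `L ∈ DTIME(2^{(5e₀+1)n})`.

## References

* H. Buhrman, L. Fortnow, A. Pavan, *Some results on derandomization*, Theory Comput. Syst. 38
  (2005), proof of Thm. 3.1 (p. 6 of the authors' version) [BuhrmanFortnowPavan2004].
* R. Impagliazzo, V. Kabanets, A. Wigderson, *In search of an easy witness: exponential time vs.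
  probabilistic polynomial time*, J. Comput. Syst. Sci. 65 (2002) (the cited translation lemma).
* S. Aaronson, D. van Melkebeek, *On circuit lower bounds from derandomization*, Theory of
  Computing 7 (2011), §3.3 (the complete problem of `NTIME(2^{O(n)})` under linear-time reductions)
  [AaronsonMelkebeek2011].
* S. Arora, B. Barak, *Computational Complexity: A Modern Approach*, CUP 2009, Thm. 1.9, §1.4.1,
  Thm. 2.9 [AroraBarakCC2009].
-/

noncomputable section

namespace Literature.Computability.MetaComplexity

open _root_.Computability Turing Polynomial Complexity Complexity.AvM Complexity.ClockedUA Brick Plumb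
  Nondeterministic

namespace AvgNEU

/-! ### A. `K U ∈ NTIME(2^{c₁ n})` -/

/-- The arithmetic of the verifier of `K U`: its witness-independent running time is
`O(2^{c₁ n})` for an explicit `c₁ ≥ 1` (cf. `AvM.exists_time_const`, which records `O(2^{n²})`).
[folklore] -/
theorem exists_time_const_lin (a k C : ℕ) (q : Polynomial ℕ) : ∃ B c₁ : ℕ, 1 ≤ c₁ ∧ ∀ n : ℕ,
    a * (3 * (2 * n + 2 ^ n + 3) + 3) ^ k + a + (q.eval (2 * n + 2 ^ n + 3) + (C * 2 ^ n + C))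
      + 3 * (2 * n + 2 ^ n + 3) + 2 * (2 * n + 2 ^ n + 3 + 1) + 2 * n + 11 ≤ B * 2 ^ (c₁ * n) + B := by
  obtain ⟨A, d, hA⟩ := exists_eval_le_mul_pow_add q
  refine ⟨a * 21 ^ k + A * 6 ^ d + C + 32 + (a + A + C + 13), k + d + 1, by omega, fun n => ?_⟩
  set m := 2 ^ n with hm
  set T := 2 ^ ((k + d + 1) * n) with hT
  have hm1 : 1 ≤ m := Nat.one_le_two_pow
  have hnm : n ≤ m := Nat.lt_two_pow_self.le
  have hTm : ∀ j, j ≤ k + d + 1 → m ^ j ≤ T := fun j hj => by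
    rw [hT, hm, ← pow_mul, Nat.mul_comm]
    exact Nat.pow_le_pow_right Nat.two_pos (Nat.mul_le_mul_right n hj)
  have hmk : m ^ k ≤ T := hTm k (by omega)
  have hmd : m ^ d ≤ T := hTm d (by omega)
  have hmT : m ≤ T := by simpa using hTm 1 (by omega)
  have h1 : a * (3 * (2 * n + m + 3) + 3) ^ k ≤ a * 21 ^ k * T := by
    have h : 3 * (2 * n + m + 3) + 3 ≤ 21 * m := by omega
    calc a * (3 * (2 * n + m + 3) + 3) ^ k ≤ a * (21 * m) ^ k :=
          Nat.mul_le_mul_left a (Nat.pow_le_pow_left h k)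
      _ = a * 21 ^ k * m ^ k := by rw [mul_pow, mul_assoc]
      _ ≤ a * 21 ^ k * T := Nat.mul_le_mul_left _ hmk
  have h2 : q.eval (2 * n + m + 3) ≤ A * 6 ^ d * T + A := by
    have h : 2 * n + m + 3 ≤ 6 * m := by omega
    calc q.eval (2 * n + m + 3) ≤ A * (2 * n + m + 3) ^ d + A := hA _
      _ ≤ A * (6 * m) ^ d + A := by gcongr
      _ = A * 6 ^ d * m ^ d + A := by rw [mul_pow, mul_assoc]
      _ ≤ A * 6 ^ d * T + A := by gcongr
  have h3 : C * m + C + 3 * (2 * n + m + 3) + 2 * (2 * n + m + 3 + 1) + 2 * n + 11 ≤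
      (C + 32) * T + (C + 13) := by
    have e1 : C * m ≤ C * T := Nat.mul_le_mul_left C hmT
    nlinarith [e1, hmT, hnm]
  have e3 : (a * 21 ^ k + A * 6 ^ d + C + 32 + (a + A + C + 13)) * T =
      a * 21 ^ k * T + A * 6 ^ d * T + (C + 32) * T + (a + A + C + 13) * T := by ring
  rw [e3]
  nlinarith [h1, h2, h3, Nat.zero_le ((a + A + C + 13) * T), Nat.zero_le (a * 21 ^ k),
    Nat.zero_le (A * 6 ^ d)]

/-- **`K U ∈ NTIME(2^{c₁n})` for `U ∈ P`, for some `c₁ ≥ 1`** (the verifier of `AvM.K_mem_NTIME` —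
truncating wrapper of the exponential clock followed by the decider of the core — with its running
time re-estimated as linear-exponential). [cite: AaronsonMelkebeek2011, §3.3] -/
theorem K_mem_NTIME_lin {U : Language Bool} (hU : U ∈ Classes.P) :
    ∃ c₁ : ℕ, 1 ≤ c₁ ∧ K U ∈ NTIME (fun n => 2 ^ (c₁ * n)) := by
  -- a decider of the core
  have hD := core_mem_P hU
  simp only [Classes.P, Set.mem_iUnion] at hD
  obtain ⟨k, a, hdec⟩ := hD
  obtain ⟨MD, hMD⟩ := (hdec : TimeDecidable id (core U) fun n => a * n ^ k + a)
  -- the clocks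
  obtain ⟨C, F, hF⟩ := exists_timeComputable_expClock 1 (k := 1) le_rfl
  obtain ⟨q, G, hG⟩ := exists_machine_pair_ones (X : Polynomial ℕ)
  obtain ⟨B, c₁, hc₁, hB⟩ := exists_time_const_lin a k C q
  let V : TM2ComputableAux Bool Bool := (truncMapAux (F.comp G)).comp MD
  refine ⟨c₁, hc₁, 2 * B + 2, fun w y => (core U).boolIndicator
      (boolPair (expClock 1 1 w) (y.take ((expClock 1 1 w).length + 1))), V,
    fun w y hy => ?_, fun w => ?_⟩
  · -- running time
    have hFw : F.OutputsWithin w (expClock 1 1 w) (C * 2 ^ (w.length ^ 1) + C) := hF w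
    have hGw := hG (expClock 1 1 w)
    simp only [eval_X] at hGw
    have hNc := TM2ComputableAux.comp_outputsWithin F G hFw hGw
    have h₁ := outputsWithin_truncMapAux_boolPair (F.comp G) (y := y) hNc
    simp only [List.length_replicate] at h₁
    have h₂ : MD.OutputsWithin (boolPair (expClock 1 1 w) (y.take ((expClock 1 1 w).length + 1)))
        (encodeBool ((core U).boolIndicator
          (boolPair (expClock 1 1 w) (y.take ((expClock 1 1 w).length + 1)))))
        (a * (3 * (expClock 1 1 w).length + 3) ^ k + a) := by
      refine (hMD (boolPair (expClock 1 1 w) (y.take ((expClock 1 1 w).length + 1)))).mono ?_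
      simp only [id, length_boolPair]
      have : (y.take ((expClock 1 1 w).length + 1)).length ≤ (expClock 1 1 w).length + 1 :=
        List.length_take_le _ _
      exact Nat.add_le_add_right (Nat.mul_le_mul_left a (Nat.pow_le_pow_left (by omega) k)) a
    have h := TM2ComputableAux.comp_outputsWithin _ _ h₁ h₂
    refine h.mono ?_
    have hℓ : (expClock 1 1 w).length = 2 * w.length + 2 ^ w.length + 3 := by
      simp only [length_expClock, pow_one, one_mul]; omega
    rw [hℓ, pow_one]
    have hBn := hB w.length
    have hP2 : (2 * B + 2) * 2 ^ (c₁ * w.length) =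
        2 * (B * 2 ^ (c₁ * w.length)) + 2 * 2 ^ (c₁ * w.length) := by ring
    have hy2 : 2 * (y.length / 2) ≤ 2 * (B * 2 ^ (c₁ * w.length)) + 2 * 2 ^ (c₁ * w.length) + (2 * B + 2) :=
      (Nat.mul_div_le y.length 2).trans (hP2 ▸ hy)
    show _ ≤ (2 * B + 2) * 2 ^ (c₁ * w.length) + (2 * B + 2)
    rw [hP2]
    omega
  · -- correctness
    have hind : ∀ z : List Bool, (core U).boolIndicator z = true ↔ z ∈ core U :=
      fun z => (Set.mem_iff_boolIndicator _ _).symm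
    have ho := expClock_one_one w
    have hlt : bitsToNat (nthF 2 w) < 2 ^ w.length :=
      (bitsToNat_lt _).trans_le (Nat.pow_le_pow_right two_pos (length_nthF_le 2 w))
    have hpow : 2 ^ w.length ≤ 2 ^ (c₁ * w.length) :=
      Nat.pow_le_pow_right two_pos (Nat.le_mul_of_pos_left _ hc₁)
    have hℓ : (expClock 1 1 w).length = 2 * w.length + 2 ^ w.length + 3 := by
      simp only [length_expClock, pow_one, one_mul]; omega
    rw [mem_K_iff]
    constructor
    · rintro ⟨y, hy, hq⟩
      refine ⟨y, ?_, ?_⟩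
      · show y.length ≤ (2 * B + 2) * 2 ^ (c₁ * w.length) + (2 * B + 2)
        nlinarith
      · rw [hind, List.take_of_length_le (by omega), ho, mem_core_iff]
        exact ⟨hy, hq⟩
    · rintro ⟨y, -, hR⟩
      rw [hind, ho, mem_core_iff] at hR
      exact ⟨_, hR.1, hR.2⟩

/-! ### B. The explicit linear-length reduction to `K U` -/

/-- The numeral of the admissible witness length `c · 2^{c₀|x|} + c` of an `NTIME(2^{c₀n})`
verifier, as an `FP` brick. [folklore] -/
def sNumF (c c₀ : ℕ) : List Bool → List Bool :=
  addFn ∘ fanoutFn (prodFn ∘ fanoutFn (fun _ => encodeNat c) (AvgNE.pow2NumF c₀)) fun _ => encodeNat c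

/-- `sNumF c c₀ ∈ FP`. [folklore] -/
theorem sNumF_mem_FP (c c₀ : ℕ) : sNumF c c₀ ∈ FP :=
  comp_mem_FP addFn_mem_FP (fanoutFn_mem_FP (comp_mem_FP prodFn_mem_FP
    (fanoutFn_mem_FP (const_mem_FP _) (AvgNE.pow2NumF_mem_FP c₀))) (const_mem_FP _))

/-- Value of `sNumF`: the numeral of `c · 2^{c₀|x|} + c`. [folklore] -/
theorem sNumF_apply (c c₀ : ℕ) (x : List Bool) :
    sNumF c c₀ x = encodeNat (c * 2 ^ (c₀ * x.length) + c) := by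
  simp [sNumF, Function.comp_apply, fanoutFn_apply, AvgNE.bitsToNat_pow2NumF]

/-- **Every `NTIME(2^{c₀n})` language reduces to `K U` (`U` the clocked universal acceptance
language) by an explicit `FP` map of slope `2 + 3c₀`**: `x ↦ ⟨x, ⟨code M, ⟨bin s, 1^{P}⟩⟩⟩` with
`s = c · 2^{c₀|x|} + c` the exact admissible witness length of the verifier `M` of `L` and the pad
`P = c₀|x| + c + h + 1`, `h` the (linear) simulation overhead of `M`, making the budget
`2^{|instance|} ≥ h · s` (Aaronson–van Melkebeek 2011, §3.3: the reduction `x ↦ ⟨M_L, x, t_L(|x|)⟩`;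
`AvM.reduction` with the advice made computable and its length explicit).
[cite: AaronsonMelkebeek2011, §3.3] [cite: AroraBarakCC2009, Thm. 1.9 and §1.4.1] -/
theorem exists_reduction {L : Language Bool} {c₀ : ℕ} (hL : L ∈ NTIME (fun n => 2 ^ (c₀ * n))) :
    ∃ r : List Bool → List Bool, r ∈ FP ∧ ∃ β : ℕ, (∀ x, (r x).length ≤ (2 + 3 * c₀) * x.length + β) ∧
      ∀ x : List Bool, x ∈ L ↔ r x ∈ K U := by
  obtain ⟨c, R, M, hM, hLR⟩ := hL
  -- the admissible witness length and the pad
  let s : ℕ → ℕ := fun n => c * 2 ^ (c₀ * n) + c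
  let h : ℕ := FlatProg.haltAddr (cM M)
  let P : ℕ → ℕ := fun n => c₀ * n + (c + h + 1)
  let r : List Bool → List Bool := fun x =>
    boolPair x (boolPair (code M) (boolPair (encodeNat (s x.length)) (ones (P x.length))))
  have hr_eq : r = fanoutFn (fun w => w) (fanoutFn (fun _ => code M)
      (fanoutFn (sNumF c c₀) (polyFn (Polynomial.C c₀ * X + Polynomial.C (c + h + 1))))) := by
    funext x
    simp only [r, fanoutFn_apply, sNumF_apply, polyFn_apply, eval_add, eval_mul, eval_C, eval_X, s, P]
  have hrFP : r ∈ FP := by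
    rw [hr_eq]
    exact fanoutFn_mem_FP OracleCompose.id_mem_FP (fanoutFn_mem_FP (const_mem_FP _)
      (fanoutFn_mem_FP (sNumF_mem_FP c c₀) (polyFn_mem_FP _)))
  have hslen : ∀ n, (encodeNat (s n)).length ≤ c₀ * n + c + 1 := fun n => by
    rw [TM2Pass.length_encodeNat_eq_size]
    exact Nat.size_le.2 (mul_two_pow_add_lt c (c₀ * n))
  refine ⟨r, hrFP, 2 * (code M).length + 2 * (c + 1) + (c + h + 1) + 8, fun x => ?_, fun x => ?_⟩
  · -- length
    have := hslen x.length
    simp only [r, length_boolPair, ones, List.length_replicate, P]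
    nlinarith
  · -- the reduction
    set n := x.length with hn
    set w := r x with hw
    have hw' : w = boolPair x (boolPair (code M) (boolPair (encodeNat (s n)) (ones (P n)))) := rfl
    have h0 : nthF 0 w = x := by rw [hw', nthF_zero_boolPair]
    have h1 : nthF 1 w = code M := by rw [hw', nthF_succ_boolPair, nthF_zero_boolPair]
    have h2 : nthF 2 w = encodeNat (s n) := by
      rw [hw', nthF_succ_boolPair, nthF_succ_boolPair, nthF_zero_boolPair]
    have hbudget : (pM M).eval (s n) ≤ 2 ^ w.length + 1 := by
      have hT : s n < 2 ^ (c₀ * n + c + 1) := mul_two_pow_add_lt c (c₀ * n)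
      have hh : h < 2 ^ h := Nat.lt_two_pow_self
      have hPw : P n ≤ w.length := by
        simp only [hw', length_boolPair, ones, List.length_replicate]; omega
      calc (pM M).eval (s n) = h * s n := by simp [pM, h]
        _ ≤ 2 ^ h * 2 ^ (c₀ * n + c + 1) := Nat.mul_le_mul hh.le hT.le
        _ = 2 ^ (P n) := by rw [← pow_add]; simp only [P]; ring_nf
        _ ≤ 2 ^ w.length := Nat.pow_le_pow_right two_pos hPw
        _ ≤ 2 ^ w.length + 1 := Nat.le_succ _
    have hquery : ∀ y : List Bool, query w y =
        inst M (boolPair x y) (List.replicate (2 ^ w.length + 1) true) := by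
      intro y
      rw [query, h1, h0]
      rfl
    rw [mem_K_iff, h2, bitsToNat_encodeNat]
    constructor
    · intro hx
      obtain ⟨y, hy, hRy⟩ := (hLR x).1 hx
      have hMy : M.OutputsWithin (boolPair x y) [true] (s n) := by
        have := hM x y hy
        rwa [hRy] at this
      exact ⟨y, hy, by rw [hquery]; exact complete M hMy hbudget⟩
    · rintro ⟨y, hy, hq⟩
      rw [hquery] at hq
      obtain ⟨t, ht⟩ := sound M hq
      have heq := outputsWithin_unique M ht (hM x y hy)
      have hR : R x y = true := by
        have he : encodeBool (R x y) = [R x y] := rfl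
        rw [he] at heq
        simpa using heq.symm
      exact (hLR x).2 ⟨y, hy, hR⟩

end AvgNEU

open AvgNEU

/-! ### C. The uniform collapse -/

/-- **Under `DistNP ⊆ AvgP`, `NTIME(2ⁿ) ⊆ DTIME(2^{en})` for one constant `e`** (the step
"`E = NE` ⟹ [IKW02] `NTIME(2ⁿ) ⊆ DTIME(2^{en})` for a fixed `e`" of Buhrman–Fortnow–Pavan's proof of
Thm. 3.1, proved directly from the average-case hypothesis through the complete language
`AvM.K U`: it is in `NTIME(2^{c₁n}) ⊆ E` by `NTIME_two_pow_mul_subset_E_of_DistNP_subset_AvgP`, say in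
`DTIME(2^{e₀n})`, and every `L ∈ NTIME(2ⁿ)` is its preimage under a reduction of slope `5`
(`AvgNEU.exists_reduction`), so `L ∈ DTIME(2^{(5e₀+1)n})`).
[cite: BuhrmanFortnowPavan2004, Thm. 3.1 (proof) and Thm. 3.5] [cite: AaronsonMelkebeek2011, §3.3] -/
theorem exists_NTIME_two_pow_subset_DTIME_of_DistNP_subset_AvgP (hD : DistNP ⊆ AvgP) :
    ∃ e : ℕ, NTIME (fun n => 2 ^ n) ⊆ DTIME (fun n => 2 ^ (e * n)) := by
  obtain ⟨c₁, hc₁, hK⟩ := K_mem_NTIME_lin U_mem_P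
  have hKE : K U ∈ E := NTIME_two_pow_mul_subset_E_of_DistNP_subset_AvgP hD hc₁ hK
  simp only [E, Set.mem_iUnion] at hKE
  obtain ⟨e₀, a₀, hdec⟩ := hKE
  have hdec' : TimeComputable (id : List Bool → List Bool) encodeBool (K U).boolIndicator
      fun n => a₀ * 2 ^ (e₀ * n) + a₀ := hdec
  refine ⟨5 * e₀ + 1, fun L hL => ?_⟩
  have hL' : L ∈ NTIME (fun n => 2 ^ (1 * n)) := by simpa only [Nat.one_mul] using hL
  obtain ⟨r, hr, β, hlen, hred⟩ := exists_reduction hL'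
  obtain ⟨p, hp⟩ := hr
  have hmono : Monotone fun n : ℕ => a₀ * 2 ^ (e₀ * n) + a₀ := fun x y hxy => by
    dsimp only
    have : 2 ^ (e₀ * x) ≤ 2 ^ (e₀ * y) := Nat.pow_le_pow_right two_pos (Nat.mul_le_mul_left e₀ hxy)
    exact Nat.add_le_add_right (Nat.mul_le_mul_left a₀ this) a₀
  have hlen' : ∀ x : List Bool, (id (r x) : List Bool).length ≤
      (2 + 3 * 1) * (id x : List Bool).length + β := fun x => hlen x
  obtain ⟨C, hC⟩ := TimeComputable.comp_holds hdec' hp hmono (s := fun n => (2 + 3 * 1) * n + β) hlen'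
  have hind : (K U).boolIndicator ∘ r = L.boolIndicator := by
    funext x
    simp only [Function.comp_apply]
    rw [Bool.eq_iff_iff, ← Set.mem_iff_boolIndicator, ← Set.mem_iff_boolIndicator]
    exact (hred x).symm
  rw [hind] at hC
  -- the bound `C (p n + (a₀ 2^{e₀(5n+β)} + a₀) + (5n+β)) + C ≤ K' 2^{(5e₀+1)n} + K'`
  obtain ⟨b, hb⟩ := TimeConstructible.exists_poly_le_two_pow_pow p le_rfl
  let K' : ℕ := C * b + C * a₀ * 2 ^ (e₀ * β) + 5 * C + (C * b + C * a₀ + C * β + C)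
  refine ⟨K', ?_⟩
  obtain ⟨MC, hMC⟩ := hC
  refine ⟨MC, fun x => (hMC x).mono ?_⟩
  set n := (id x : List Bool).length with hn
  have hbn := hb n
  simp only [pow_one] at hbn
  set T := 2 ^ ((5 * e₀ + 1) * n) with hT
  have h2n : 2 ^ n ≤ T := Nat.pow_le_pow_right two_pos (by nlinarith)
  have hexp : 2 ^ (e₀ * ((2 + 3 * 1) * n + β)) = 2 ^ (e₀ * β) * 2 ^ (5 * e₀ * n) := by
    rw [← pow_add]; ring_nf
  have h5 : 2 ^ (5 * e₀ * n) ≤ T := Nat.pow_le_pow_right two_pos (by nlinarith)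
  have hnT : n ≤ T := Nat.lt_two_pow_self.le.trans h2n
  show C * (p.eval n + (a₀ * 2 ^ (e₀ * ((2 + 3 * 1) * n + β)) + a₀) + ((2 + 3 * 1) * n + β)) + C ≤
    K' * T + K'
  rw [hexp]
  have e1 : C * p.eval n ≤ C * b * T + C * b := by
    have := Nat.mul_le_mul_left C (hbn.trans (Nat.add_le_add_right (Nat.mul_le_mul_left b h2n) b))
    nlinarith
  have e2 : C * (a₀ * (2 ^ (e₀ * β) * 2 ^ (5 * e₀ * n))) ≤ C * a₀ * 2 ^ (e₀ * β) * T := by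
    have := Nat.mul_le_mul_left (C * a₀ * 2 ^ (e₀ * β)) h5
    nlinarith
  have e3 : C * ((2 + 3 * 1) * n) ≤ 5 * C * T := by nlinarith
  have hT1 : 1 ≤ T := Nat.one_le_two_pow
  have expand : C * (p.eval n + (a₀ * (2 ^ (e₀ * β) * 2 ^ (5 * e₀ * n)) + a₀) + ((2 + 3 * 1) * n + β)) + C =
      C * p.eval n + C * (a₀ * (2 ^ (e₀ * β) * 2 ^ (5 * e₀ * n))) + C * ((2 + 3 * 1) * n) +
        (C * a₀ + C * β + C) := by ring
  rw [expand]
  have eK : K' * T + K' = (C * b + C * a₀ * 2 ^ (e₀ * β) + 5 * C) * T +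
      (C * b + C * a₀ + C * β + C) * T + K' := by simp only [K']; ring
  rw [eK]
  nlinarith [e1, e2, e3, hT1, Nat.zero_le ((C * b + C * a₀ + C * β + C) * T),
    Nat.zero_le K']

end Literature.Computability.MetaComplexity

end
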